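import Mathlib
import Summits.Parity.BatemanHorn.Theorems.IsogenyRedeiTypeIMainTermWeights
import HarnessLib

/-!
# Type-I main term for Bateman–Horn (stmt-Parity-0873), input B3:
# `ψ_i`, `𝒻_i = μ ψ_i`, `𝓮 = 𝒶 ⋆ ∏ ψ_i`, the exact identity, and values at prime powers

With `g_i(p) = ρ_{f_i}(p)/p` (`rootDensity (f i) p`): `gcm f i` is the completely multiplicative
extension of `g_i` (`= rootDensity (f i) n` on square-free `n`); `psiFun f i (n) = gcm_i(n)(1 + ε_i log n)`
is completely multiplicative; `fFun f i = μ ψ_i` with `fFun_mul_psiFun : 𝒻_i ⋆ ψ_i = 1`;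
`eFun f = 𝒶 ⋆ ∏_i ψ_i` is multiplicative and **`aFun_eq_eFun_mul_prod_fFun : 𝒶 = 𝓮 ⋆ ∏_i 𝒻_i`**;
`mul_apply_prime_pow : (F ⋆ G)(p^e) = ∑_{j ≤ e} F(p^j) G(p^{e-j})`. Everything here is proved.
-/

noncomputable section

open Finset Polynomial ArithmeticFunction
open scoped ArithmeticFunction.Moebius

namespace Summit.Parity.BatemanHorn.Theorems.TypeIMainTerm

open Literature.NumberTheory.Sieve

variable {k : ℕ} (f : Fin k → ℤ[X])

/-! ### Dirichlet products at prime powers -/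

/-- `(F ⋆ G)(p^e) = ∑_{j ≤ e} F(p^j) G(p^{e−j})`. -/
theorem mul_apply_prime_pow {R : Type*} [CommSemiring R] (F G : ArithmeticFunction R) {p : ℕ}
    (hp : p.Prime) (e : ℕ) :
    (F * G) (p ^ e) = ∑ j ∈ Finset.range (e + 1), F (p ^ j) * G (p ^ (e - j)) := by
  rw [ArithmeticFunction.mul_apply, ← Nat.map_div_right_divisors, Finset.sum_map,
    Nat.divisors_prime_pow hp, Finset.sum_map]
  refine Finset.sum_congr rfl fun j hj => ?_
  simp only [Function.Embedding.coeFn_mk]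
  rw [Nat.pow_div (Nat.lt_succ_iff.mp (Finset.mem_range.mp hj)) hp.pos]

/-! ### The completely multiplicative extension of `g_i` -/

/-- `gcm f i 1 = 1`. -/
theorem gcm_one (i : Fin k) : gcm f i 1 = 1 := by
  rw [gcm_of_ne_zero f i one_ne_zero, Nat.factorization_one, Finsupp.prod_zero_index]

/-- Complete multiplicativity. -/
theorem gcm_mul (i : Fin k) {m n : ℕ} (hm : m ≠ 0) (hn : n ≠ 0) :
    gcm f i (m * n) = gcm f i m * gcm f i n := by
  rw [gcm_of_ne_zero f i (Nat.mul_ne_zero hm hn), gcm_of_ne_zero f i hm, gcm_of_ne_zero f i hn,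
    Nat.factorization_mul hm hn, Finsupp.prod_add_index' (fun _ => pow_zero _) (fun _ _ _ => pow_add _ _ _)]

/-- `gcm f i (p ^ v) = rootDensity (f i) p ^ v`. -/
theorem gcm_prime_pow (i : Fin k) {p : ℕ} (hp : p.Prime) (v : ℕ) :
    gcm f i (p ^ v) = rootDensity (f i) p ^ v := by
  rw [gcm_of_ne_zero f i (pow_ne_zero v hp.ne_zero), hp.factorization_pow]
  exact Finsupp.prod_single_index (by simp)

/-- `0 ≤ gcm f i n`. -/
theorem gcm_nonneg (i : Fin k) (n : ℕ) : 0 ≤ gcm f i n := by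
  rcases eq_or_ne n 0 with rfl | hn
  · rw [gcm_zero]
  · rw [gcm_of_ne_zero f i hn]
    exact Finset.prod_nonneg fun p _ => pow_nonneg (rootDensity_nonneg _ _) _

/-- On square-free `n`, `gcm` is the root density `rootDensity (f i) n` (CRT multiplicativity). -/
theorem gcm_eq_rootDensity_of_squarefree (i : Fin k) {n : ℕ} (hn : Squarefree n) :
    gcm f i n = rootDensity (f i) n := by
  have hmult := isMultiplicative_rootDensity (f i)
  rw [← hmult.prod_primeFactors hn, gcm_of_ne_zero f i hn.ne_zero, Finsupp.prod,
    Nat.support_factorization]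
  refine Finset.prod_congr rfl fun p hp => ?_
  obtain ⟨hp1, hp2, -⟩ := Nat.mem_primeFactors.mp hp
  rw [Nat.factorization_eq_one_of_squarefree hn hp1 hp2, pow_one]

/-! ### `ψ_i` and `𝒻_i` -/

/-- `psiFun f i 1 = 1`. -/
theorem psiFun_one (i : Fin k) : psiFun f i 1 = 1 := by
  rw [psiFun_apply, gcm_one, one_smul, Nat.cast_one, Real.log_one, SAlg.lin_one_zero]

/-- **Complete multiplicativity of `ψ_i`** (`ε_i² = 0`). -/
theorem psiFun_mul (i : Fin k) {m n : ℕ} (hm : m ≠ 0) (hn : n ≠ 0) :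
    psiFun f i (m * n) = psiFun f i m * psiFun f i n := by
  rw [psiFun_apply, psiFun_apply, psiFun_apply, SAlg.smul_mul, SAlg.mul_smul', smul_smul,
    SAlg.lin_mul_lin, gcm_mul f i hm hn, Nat.cast_mul,
    Real.log_mul (by exact_mod_cast hm) (by exact_mod_cast hn)]
  ext S
  simp only [SAlg.coeff_smul, SAlg.coeff_lin]
  split_ifs <;> ring

/-- `(psiFun f i).IsMultiplicative`. -/
theorem isMultiplicative_psiFun (i : Fin k) : (psiFun f i).IsMultiplicative :=
  ⟨psiFun_one f i, fun {m n} hmn => by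
    rcases eq_or_ne m 0 with rfl | hm
    · simp
    rcases eq_or_ne n 0 with rfl | hn
    · simp
    exact psiFun_mul f i hm hn⟩

/-- `psiFun f i (p ^ v) = (rootDensity (f i) p ^ v) • SAlg.lin i 1 (v * Real.log p)`. -/
theorem psiFun_prime_pow (i : Fin k) {p : ℕ} (hp : p.Prime) (v : ℕ) :
    psiFun f i (p ^ v) = (rootDensity (f i) p ^ v) • SAlg.lin i 1 (v * Real.log p) := by
  rw [psiFun_apply, gcm_prime_pow f i hp, Nat.cast_pow, Real.log_pow]

/-- `𝒻_i(n) = μ(n) g_i(n) + ε_i μ(n) g_i(n) log n` with `g_i = rootDensity (f i)`. -/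
theorem fFun_eq_lin (i : Fin k) (n : ℕ) :
    fFun f i n = SAlg.lin i ((μ n : ℝ) * rootDensity (f i) n)
      ((μ n : ℝ) * rootDensity (f i) n * Real.log n) := by
  rw [fFun_apply, psiFun_apply, smul_smul]
  by_cases hsq : Squarefree n
  · rw [gcm_eq_rootDensity_of_squarefree f i hsq]
    ext S
    rw [SAlg.coeff_smul, SAlg.coeff_lin, SAlg.coeff_lin]
    split_ifs <;> ring
  · rw [ArithmeticFunction.moebius_eq_zero_of_not_squarefree hsq]
    ext S
    rw [SAlg.coeff_smul, SAlg.coeff_lin, SAlg.coeff_lin]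
    push_cast
    split_ifs <;> ring

/-- `(fFun f i).IsMultiplicative`. -/
theorem isMultiplicative_fFun (i : Fin k) : (fFun f i).IsMultiplicative := by
  refine ⟨by rw [fFun_apply, ArithmeticFunction.moebius_apply_one, Int.cast_one, one_smul,
    psiFun_one], fun {m n} hmn => ?_⟩
  rw [fFun_apply, fFun_apply, fFun_apply, (isMultiplicative_psiFun f i).map_mul_of_coprime hmn,
    ArithmeticFunction.isMultiplicative_moebius.map_mul_of_coprime hmn, Int.cast_mul,
    SAlg.smul_mul, SAlg.mul_smul', smul_smul]

/-- **`𝒻_i ⋆ ψ_i = 1`** (`ψ_i` is the Dirichlet inverse of `μ ψ_i`, being completely multiplicative). -/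
theorem fFun_mul_psiFun (i : Fin k) : fFun f i * psiFun f i = 1 := by
  ext n : 1
  rcases eq_or_ne n 0 with rfl | hn
  · simp
  rw [ArithmeticFunction.mul_apply, ArithmeticFunction.one_apply]
  have key : ∀ x ∈ n.divisorsAntidiagonal, fFun f i x.1 * psiFun f i x.2 = (μ x.1 : ℝ) • psiFun f i n := by
    intro x hx
    obtain ⟨hxn, -⟩ := Nat.mem_divisorsAntidiagonal.mp hx
    have h1 : x.1 ≠ 0 := fun h => hn (by rw [← hxn, h, zero_mul])
    have h2 : x.2 ≠ 0 := fun h => hn (by rw [← hxn, h, mul_zero])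
    rw [fFun_apply, SAlg.smul_mul, ← psiFun_mul f i h1 h2, hxn]
  rw [Finset.sum_congr rfl key, ← Finset.sum_smul, Nat.sum_divisorsAntidiagonal (fun a _ => (μ a : ℝ)),
    sum_divisors_moebius_real]
  split_ifs with h1
  · rw [h1, psiFun_one, one_smul]
  · rw [zero_smul]

/-! ### `𝓮 = 𝒶 ⋆ ∏ ψ_i` and the exact identity -/

/-- **The exact identity** `𝒶 = 𝓮 ⋆ ∏_i 𝒻_i`. -/
theorem aFun_eq_eFun_mul_prod_fFun : aFun f = eFun f * ∏ i, fFun f i := by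
  rw [eFun, mul_assoc, ← Finset.prod_mul_distrib]
  have : ∏ i : Fin k, (psiFun f i * fFun f i) = 1 :=
    Finset.prod_eq_one fun i _ => by rw [mul_comm, fFun_mul_psiFun]
  rw [this, mul_one]

/-- A finite product of multiplicative arithmetic functions is multiplicative. -/
theorem isMultiplicative_prod {R : Type*} [CommSemiring R] {ι : Type*} (s : Finset ι)
    (F : ι → ArithmeticFunction R) (h : ∀ i ∈ s, (F i).IsMultiplicative) :
    (∏ i ∈ s, F i).IsMultiplicative := by
  classical
  induction s using Finset.induction_on with
  | empty => simp [ArithmeticFunction.isMultiplicative_one (R := R)]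
  | insert a s ha ih =>
    rw [Finset.prod_insert ha]
    exact (h a (Finset.mem_insert_self a s)).mul (ih fun i hi => h i (Finset.mem_insert_of_mem hi))

/-- `(eFun f).IsMultiplicative`. -/
theorem isMultiplicative_eFun : (eFun f).IsMultiplicative :=
  (isMultiplicative_aFun f).mul (isMultiplicative_prod _ _ fun i _ => isMultiplicative_psiFun f i)

end Summit.Parity.BatemanHorn.Theorems.TypeIMainTerm

end

/-!
### Input B3 (part 2): values at prime powers — tuples with product `p^w` are tuples of powers of
`p`; `aFun_prime` (`𝒶(p) = −∑_i ψ_i(p)`), hence **`eFun_prime : 𝓮(p) = 0`**; `𝒶(p^j) = 0` for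
`j > k`, and for `j ≥ 2` at primes modulo which no two `f_i` share a root. Everything is proved. -/

noncomputable section

open Finset Polynomial ArithmeticFunction
open scoped ArithmeticFunction.Moebius

namespace Summit.Parity.BatemanHorn.Theorems.TypeIMainTerm

open Literature.NumberTheory.Sieve

variable {k : ℕ} (f : Fin k → ℤ[X])

/-! ### Tuples with prime-power product -/

/-- A tuple with product `p^w` consists of powers `p^{v_i}`, `v_i ≤ w`, `∑ v_i = w`. -/
theorem exists_pow_eq_of_mem_finMulAntidiag {p : ℕ} (hp : p.Prime) {w : ℕ} {d : Fin k → ℕ}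
    (hd : d ∈ Nat.finMulAntidiag k (p ^ w)) :
    ∃ v : Fin k → ℕ, (∀ i, d i = p ^ v i) ∧ (∀ i, v i ≤ w) ∧ ∑ i, v i = w := by
  have h : ∀ i, ∃ v ≤ w, d i = p ^ v := fun i =>
    (Nat.dvd_prime_pow hp).mp (Nat.dvd_of_mem_finMulAntidiag hd i)
  choose v hvw hdv using h
  refine ⟨v, hdv, hvw, ?_⟩
  have hprod := Nat.prod_eq_of_mem_finMulAntidiag hd
  simp_rw [hdv, Finset.prod_pow_eq_pow_sum] at hprod
  exact Nat.pow_right_injective hp.two_le hprod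

/-- There are at most `(w+1)^k` tuples with product `p^w`. -/
theorem card_finMulAntidiag_prime_pow_le {p : ℕ} (hp : p.Prime) (w : ℕ) :
    (Nat.finMulAntidiag k (p ^ w)).card ≤ (w + 1) ^ k := by
  have hn : p ^ w ≠ 0 := pow_ne_zero w hp.ne_zero
  rw [Nat.finMulAntidiag_eq_piFinset_divisors_filter (dvd_refl _) hn]
  refine (Finset.card_filter_le _ _).trans ?_
  rw [Fintype.card_piFinset, Finset.prod_const, Finset.card_univ, Fintype.card_fin,
    Nat.divisors_prime_pow hp, Finset.card_map, Finset.card_range]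

/-- **Tuples with prime product**: `∑_{∏ d = p} F(d) = ∑_i F(p e_i)`. -/
theorem sum_finMulAntidiag_prime {M : Type*} [AddCommMonoid M] {p : ℕ} (hp : p.Prime)
    (F : (Fin k → ℕ) → M) :
    ∑ d ∈ Nat.finMulAntidiag k p, F d = ∑ i : Fin k, F (Pi.mulSingle i p) := by
  classical
  have hsq : Squarefree p := hp.squarefree
  -- every tuple with product `p` is some `p e_i`
  have hstruct : ∀ d ∈ Nat.finMulAntidiag k p, ∃ i, d = Pi.mulSingle i p := by
    intro d hd
    obtain ⟨i, hi, huniq⟩ := Nat.finMulAntidiag_existsUnique_prime_dvd hsq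
      (Nat.mem_primeFactorsList hp.ne_zero |>.mpr ⟨hp, dvd_refl p⟩) d hd
    refine ⟨i, funext fun j => ?_⟩
    have hdj : d j ∣ p := Nat.dvd_of_mem_finMulAntidiag hd j
    by_cases hij : j = i
    · subst hij
      rw [Pi.mulSingle_eq_same]
      exact Nat.dvd_antisymm hdj hi
    · rw [Pi.mulSingle_eq_of_ne hij]
      rcases (Nat.dvd_prime hp).mp hdj with h1 | h1
      · exact h1
      · exact absurd (huniq j (h1 ▸ dvd_refl _)) hij
  have hmem : ∀ i : Fin k, Pi.mulSingle i p ∈ Nat.finMulAntidiag k p := by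
    intro i
    rw [Nat.mem_finMulAntidiag]
    refine ⟨?_, hp.ne_zero⟩
    rw [Finset.prod_eq_single i (fun j _ hj => Pi.mulSingle_eq_of_ne hj _) (fun h => absurd
      (Finset.mem_univ i) h), Pi.mulSingle_eq_same]
  have hinj : Function.Injective (fun i : Fin k => (Pi.mulSingle i p : Fin k → ℕ)) := by
    intro i j hij
    by_contra h
    have h1 : (Pi.mulSingle i p : Fin k → ℕ) i = (Pi.mulSingle j p : Fin k → ℕ) i := congr_fun hij i
    rw [Pi.mulSingle_eq_same, Pi.mulSingle_eq_of_ne h] at h1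
    exact hp.one_lt.ne' h1
  have himage : Nat.finMulAntidiag k p = Finset.univ.image (fun i : Fin k => Pi.mulSingle i p) := by
    ext d
    rw [Finset.mem_image]
    constructor
    · intro hd; obtain ⟨i, rfl⟩ := hstruct d hd; exact ⟨i, Finset.mem_univ i, rfl⟩
    · rintro ⟨i, -, rfl⟩; exact hmem i
  rw [himage, Finset.sum_image fun i _ j _ h => hinj h]

/-! ### The generators at prime powers -/

/-- `(moebLin i p : SAlg k) = -(SAlg.lin i 1 (Real.log p))`. -/
theorem moebLin_prime {p : ℕ} (hp : p.Prime) (i : Fin k) :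
    (moebLin i p : SAlg k) = -(SAlg.lin i 1 (Real.log p)) := by
  unfold moebLin
  rw [ArithmeticFunction.moebius_apply_prime hp]
  ext S
  rw [SAlg.coeff_neg, SAlg.coeff_lin, SAlg.coeff_lin]
  push_cast
  split_ifs <;> ring

/-- `(moebLin i (p ^ v) : SAlg k) = 0`. -/
theorem moebLin_prime_pow_of_two_le {p : ℕ} (hp : p.Prime) (i : Fin k) {v : ℕ} (hv : 2 ≤ v) :
    (moebLin i (p ^ v) : SAlg k) = 0 := by
  unfold moebLin
  rw [ArithmeticFunction.moebius_apply_prime_pow hp (by omega), if_neg (by omega)]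
  ext S
  rw [SAlg.coeff_lin, SAlg.coeff_zero]
  push_cast
  split_ifs <;> ring

/-- `lcm (p e_i) = p`. -/
theorem tupleLcm_mulSingle (p : ℕ) (i : Fin k) : tupleLcm (Pi.mulSingle i p : Fin k → ℕ) = p := by
  refine Nat.dvd_antisymm (Finset.lcm_dvd fun j _ => ?_) ?_
  · by_cases hj : j = i
    · subst hj; rw [Pi.mulSingle_eq_same]
    · rw [Pi.mulSingle_eq_of_ne hj]; exact one_dvd _
  · have := dvd_tupleLcm (Pi.mulSingle i p : Fin k → ℕ) i
    rwa [Pi.mulSingle_eq_same] at this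

/-- `ρ(p e_i) = ρ_{f_i}(p)`. -/
theorem sysCount_mulSingle (p : ℕ) (i : Fin k) :
    sysCount f (Pi.mulSingle i p) = polyRootCountMod ![f i] p := by
  classical
  rw [sysCount, tupleLcm_mulSingle, polyRootCountMod_single]
  unfold sysSols
  congr 1
  refine Finset.filter_congr fun n _ => ⟨fun h => by simpa using h i, fun h j => ?_⟩
  by_cases hj : j = i
  · subst hj; simpa using h
  · rw [Pi.mulSingle_eq_of_ne hj]; simp

/-- `G(p e_i) = g_i(p) = ρ_{f_i}(p)/p`. -/
theorem sysDensity_mulSingle (p : ℕ) (i : Fin k) :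
    sysDensity f (Pi.mulSingle i p) = rootDensity (f i) p := by
  rw [sysDensity, sysCount_mulSingle f p, tupleLcm_mulSingle, rootDensity_apply]

/-- `cWeight (p e_i) = −g_i(p) (1 + ε_i log p)`. -/
theorem cWeight_mulSingle {p : ℕ} (hp : p.Prime) (i : Fin k) :
    cWeight f (Pi.mulSingle i p) = -(rootDensity (f i) p • SAlg.lin i 1 (Real.log p)) := by
  unfold cWeight
  rw [sysDensity_mulSingle f p, Finset.prod_eq_single i (fun j _ hj => by
    rw [Pi.mulSingle_eq_of_ne hj, moebLin_one]) (fun h => absurd (Finset.mem_univ i) h),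
    Pi.mulSingle_eq_same, moebLin_prime hp, smul_neg]

/-- **`𝒶(p) = −∑_i ψ_i(p)`.** -/
theorem aFun_prime {p : ℕ} (hp : p.Prime) : aFun f p = -∑ i, psiFun f i p := by
  rw [aFun_apply, sum_finMulAntidiag_prime hp, ← Finset.sum_neg_distrib]
  refine Finset.sum_congr rfl fun i _ => ?_
  rw [cWeight_mulSingle f hp, psiFun_apply]
  have : gcm f i p = rootDensity (f i) p := by
    have h := gcm_prime_pow f i hp 1
    rwa [pow_one, pow_one] at h
  rw [this]

/-- `(∏_i ψ_i)(p) = ∑_i ψ_i(p)`. -/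
theorem prod_psiFun_prime {p : ℕ} (hp : p.Prime) : (∏ i, psiFun f i) p = ∑ i, psiFun f i p := by
  rw [ArithmeticFunction.prod_apply_eq_sum_finMulAntidiag, sum_finMulAntidiag_prime hp]
  refine Finset.sum_congr rfl fun i _ => ?_
  rw [Finset.prod_eq_single i (fun j _ hj => by rw [Pi.mulSingle_eq_of_ne hj, psiFun_one])
    (fun h => absurd (Finset.mem_univ i) h), Pi.mulSingle_eq_same]

/-- **`𝓮(p) = 0` at every prime.** -/
theorem eFun_prime {p : ℕ} (hp : p.Prime) : eFun f p = 0 := by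
  rw [eFun, ← pow_one p, mul_apply_prime_pow _ _ hp, Finset.sum_range_succ, Finset.sum_range_one]
  simp only [pow_zero, Nat.sub_zero, pow_one, Nat.sub_self]
  rw [(isMultiplicative_aFun f).map_one, one_mul,
    (isMultiplicative_prod _ _ fun i _ => isMultiplicative_psiFun f i).map_one, mul_one,
    prod_psiFun_prime f hp, aFun_prime f hp, add_neg_cancel]

/-! ### Vanishing of `𝒶(p^j)` -/

/-- A tuple term with a coordinate `p^v`, `v ≥ 2`, vanishes. -/
theorem cWeight_eq_zero_of_two_le {p : ℕ} (hp : p.Prime) {d : Fin k → ℕ} {v : Fin k → ℕ}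
    (hdv : ∀ i, d i = p ^ v i) {i : Fin k} (hi : 2 ≤ v i) : cWeight f d = 0 := by
  unfold cWeight
  rw [Finset.prod_eq_zero (Finset.mem_univ i) (by rw [hdv i, moebLin_prime_pow_of_two_le hp i hi]),
    smul_zero]

/-- **`𝒶(p^j) = 0` for `j > k`.** -/
theorem aFun_prime_pow_eq_zero_of_lt {p : ℕ} (hp : p.Prime) {j : ℕ} (hj : k < j) :
    aFun f (p ^ j) = 0 := by
  rw [aFun_apply]
  refine Finset.sum_eq_zero fun d hd => ?_
  obtain ⟨v, hdv, -, hsum⟩ := exists_pow_eq_of_mem_finMulAntidiag hp hd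
  -- some `v i ≥ 2`, otherwise `∑ v ≤ k`
  by_contra hne
  have hle : ∀ i, v i ≤ 1 := fun i => by
    by_contra h
    exact hne (cWeight_eq_zero_of_two_le f hp hdv (i := i) (by omega))
  have : ∑ i, v i ≤ k := by
    calc ∑ i, v i ≤ ∑ _i : Fin k, 1 := Finset.sum_le_sum fun i _ => hle i
      _ = k := by simp
  omega

/-- **At a prime modulo which no two members have a common root, `𝒶(p^j) = 0` for `j ≥ 2`.** -/
theorem aFun_prime_pow_eq_zero_of_good {p : ℕ} (hp : p.Prime)
    (hgood : ∀ i i' : Fin k, i ≠ i' → ∀ n : ℕ,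
      ¬(((p : ℕ) : ℤ) ∣ (f i).eval (n : ℤ) ∧ ((p : ℕ) : ℤ) ∣ (f i').eval (n : ℤ)))
    {j : ℕ} (hj : 2 ≤ j) : aFun f (p ^ j) = 0 := by
  classical
  rw [aFun_apply]
  refine Finset.sum_eq_zero fun d hd => ?_
  obtain ⟨v, hdv, -, hsum⟩ := exists_pow_eq_of_mem_finMulAntidiag hp hd
  by_cases hex : ∃ i, 2 ≤ v i
  · obtain ⟨i, hi⟩ := hex
    exact cWeight_eq_zero_of_two_le f hp hdv hi
  push Not at hex
  -- all `v i ≤ 1`; the set `T = {i : v i = 1}` has `∑ v = #T ≥ 2` elements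
  set T := Finset.univ.filter (fun i => v i = 1) with hT
  have hcard : T.card = ∑ i, v i := by
    rw [Finset.card_eq_sum_ones, Finset.sum_filter]
    refine Finset.sum_congr rfl fun i _ => ?_
    have := hex i
    interval_cases (v i) <;> simp
  have h2 : 1 < T.card := by omega
  obtain ⟨i, hi, i', hi', hii'⟩ := Finset.one_lt_card.mp h2
  have hvi : v i = 1 := (Finset.mem_filter.mp hi).2
  have hvi' : v i' = 1 := (Finset.mem_filter.mp hi').2
  -- then `ρ(d) = 0`
  have hcount : sysCount f d = 0 := by
    rw [sysCount, Finset.card_eq_zero, Finset.eq_empty_iff_forall_notMem]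
    intro n hn
    rw [mem_sysSols] at hn
    refine hgood i i' hii' n ⟨?_, ?_⟩
    · have := hn.2 i; rwa [hdv i, hvi, pow_one] at this
    · have := hn.2 i'; rwa [hdv i', hvi', pow_one] at this
  unfold cWeight sysDensity
  rw [hcount, Nat.cast_zero, zero_div, zero_smul]

end Summit.Parity.BatemanHorn.Theorems.TypeIMainTerm

end
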